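import Mathlib
import HarnessLib
import Summits.Ventures.LatticeQCDFlow.Scoring.FreeBoundaryIndependence2D
import Summits.Ventures.LatticeQCDFlow.Scaling.AutoregressiveGaugePlaquetteTVFloorAnyLink
import Summits.Ventures.LatticeQCDFlow.Exactness.LatticeCoordAvg
import Summits.Ventures.LatticeQCDFlow.Exactness.CompactHaar

/-!
# LatticeQCDFlow / Scaling — SUFFICIENCY IN TWO DIMENSIONS: on a free-boundary block the one-plaquette
# heat-bath autoregressive model IS the target — `H_l = F/Z`, `KL(F/Z ‖ H_l) = 0` — for every compact gauge
# group, every continuous positive plaquette weight, every block and every bottom-up generation order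

HONEST FRAMING: exact (Metropolis-corrected) sampling algorithms for lattice gauge theory;
figures of merit are autocorrelation/cost numbers at stated couplings and volumes; no
continuum-physics claim.

Venture `LatticeQCDFlow` (cell pub-lqcd), topic `Scaling`, FANOUT row 30 (lean-1, GEN-22) — OUR WORK on
THEORY-2.md §4 row C5.  The lineage's NECESSITY law says: an autoregressive conditioner for a plaquette-closing
link that is blind to the other links at ONE endpoint pays `≥ (dim G/2 − o(1))·log β` nats per closing link,
whatever the architecture, so its exact sampler slows down exponentially in the volume.  This file types the
complementary SUFFICIENCY statement in the solvable case: for the free-boundary two-dimensional weight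
`F(U) = ∏_{p ∈ B} w(U_p)` of an `R × T₀` block `B` of plaquettes of `(ℤ/L)²` (links outside the block free),
the autoregressive model that draws every non-top link from Haar and every TOP link `(p + e₁, 0)` of a block
plaquette `p` from the ONE-PLAQUETTE HEAT BATH `w(U_p)/c` (`c = ∫ w dHaar`; the conditioner reads the three
other links of `p` — BOTH endpoints of the generated link) is EXACT: its density `∏_b q_b` equals `F/Z`
pointwise, because `Z = c^{R·T₀}` (row 5's column-peeling identity
`Scoring/FreeBoundaryIndependence2D.integral_mul_prod_rect_of_forall_col` with the trivial observable).  The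
conditioners are normalised in their own link (Haar invariance), squeezed, and read only the links of their
plaquette — so for every order of all links in which each top link comes after the other three links of its
plaquette (rows bottom-up) `∏_b q_b` is a genuine autoregressive model and the lineage's hybrid
`H_l = (∏_b q_b)·A_{all}F/Z` coincides with it and with the target: training loss `KL(F/Z ‖ H_l) = 0`, the
independence sampler accepts every proposal.  Reading both endpoints of the closing link is therefore not only
necessary (lineage) but, in two dimensions with free boundary, sufficient with radius-one context.

## What is proved (all [ours]; `G` compact second-countable, `w : G → ℝ` continuous and positive, `L` with
`R + 1 ≤ L`, `T₀ + 1 ≤ L`, `0 < R`; `B = {![i + a, j + b] : a < R, b < T₀}`, `F = ∏_{p∈B} w(U_p)`,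
`c = ∫ w dHaar`, `q_b(U) = ∏_{p ∈ B, (p + e₁, 0) = b} w(U_p)/c`)

* §1 **`freeBlock_integral_prod_eq_pow`** — `∫ F dHaar^{⊗E} = c^{R·T₀}`.
* §2 `filter_topLink_eq_singleton`, `filter_topLink_eq_empty`; **`heatBath_integral_update_eq_one`** —
  `∫ q_b(U[b ↦ v]) dHaar(v) = 1` for EVERY link `b`; **`heatBath_update_of_forall_ne`** — `q_b` ignores every
  link that is not a link of a block plaquette topped by `b`; **`heatBath_squeezed`** — common bounds
  `0 < m ≤ q_b ≤ M`.
* §3 **`prod_heatBath_eq`** — `∏_b q_b(U) = F(U)/c^{R·T₀}`; **`freeBlock_arHybrid_eq_target`** — for every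
  duplicate-free list `l` of ALL links, `(∏_{b∈l} q_b(U))·A_{l}F(U)/Z = F(U)/Z`;
  **`freeBlock_kl_arHybrid_eq_zero`** — `∫ (F/Z)·log((F/Z)/H_l) dHaar^{⊗E} = 0`.

NOT CLAIMED: the torus (periodic) weight in two dimensions (its last links close two plaquettes and the
Polyakov holonomies are not Haar — the heat-bath model is then only approximately exact); anything in
`d ≥ 3`.  No `def`, no `sorry`, nothing cited as a fact beyond the tree.
-/

noncomputable section

namespace Summit.Ventures.LatticeQCDFlow.Theory2.Autoregressive

open MeasureTheory Function Finset
open Literature.MathematicalPhysics.QuantumFieldTheory Literature.MathematicalPhysics.QuantumLattice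
open Summit.Ventures.LatticeQCDFlow.Exactness Summit.Ventures.LatticeQCDFlow.Scoring
open Summit.Ventures.LatticeQCDFlow.Theory2.Lattice Summit.Ventures.LatticeQCDFlow.Theory2.Lattice.TwoDim

variable {L : ℕ} [NeZero L] {G : Type*} [Group G] [TopologicalSpace G] [IsTopologicalGroup G]
  [CompactSpace G] [SecondCountableTopology G] [MeasurableSpace G] [BorelSpace G]

/-! ## §1 The block and its partition function -/

/-- **The free-boundary block partition function factorises: `∫ ∏_{p∈B} w(U_p) dHaar^{⊗E} = (∫ w dHaar)^{R·T₀}`**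
(row 5's column peeling with the trivial observable). [ours] -/
theorem freeBlock_integral_prod_eq_pow {w : G → ℝ} (hw : Continuous w) (i j : ZMod L) {R T₀ : ℕ}
    (hR0 : 0 < R) (hR : R + 1 ≤ L) (hT₀ : T₀ + 1 ≤ L) :
    ∫ U, ∏ p ∈ (range R ×ˢ range T₀).image (fun q : ℕ × ℕ => (![i + q.1, j + q.2] : Site 2 L)),
        w (plaquetteHolonomy U p 0 1) ∂(Measure.pi fun _ : Edge 2 L => haarProbability G) =
      (∫ g, w g ∂(haarProbability G)) ^ (R * T₀) := by
  have h := integral_mul_prod_rect_of_forall_col (G := G) hw i j hR0 hR (Φ := fun _ => (1 : ℂ))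
    continuous_const (fun _ _ _ _ _ => rfl) T₀ hT₀
  simp only [one_mul] at h
  have hlhs : ∫ U, ∏ p ∈ (range R ×ˢ range T₀).image (fun q : ℕ × ℕ => (![i + q.1, j + q.2] : Site 2 L)),
        (w (plaquetteHolonomy U p 0 1) : ℂ) ∂(Measure.pi fun _ : Edge 2 L => haarProbability G) =
      ((∫ U, ∏ p ∈ (range R ×ˢ range T₀).image (fun q : ℕ × ℕ => (![i + q.1, j + q.2] : Site 2 L)),
        w (plaquetteHolonomy U p 0 1) ∂(Measure.pi fun _ : Edge 2 L => haarProbability G) : ℝ) : ℂ) := by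
    rw [← integral_complex_ofReal]
    refine integral_congr_ae (ae_of_all _ fun U => ?_)
    push_cast
    rfl
  have hrhs : (∫ g, (w g : ℂ) ∂(haarProbability G)) = ((∫ g, w g ∂(haarProbability G) : ℝ) : ℂ) :=
    integral_complex_ofReal
  have hone : ∫ _U : GaugeConfig 2 L G, (1 : ℂ) ∂(Measure.pi fun _ : Edge 2 L => haarProbability G) = 1 := by
    simp
  rw [hlhs, hrhs, hone, mul_one, ← Complex.ofReal_pow] at h
  exact_mod_cast h

omit [SecondCountableTopology G] in
/-- A continuous positive function on a compact group has positive Haar integral. [folklore] -/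
theorem haarProbability_integral_pos_of_continuous_pos {w : G → ℝ} (hw : Continuous w) (hw0 : ∀ g, 0 < w g) :
    0 < ∫ g, w g ∂(haarProbability G) := by
  obtain ⟨g₀, -, hg₀⟩ := isCompact_univ.exists_isMinOn Set.univ_nonempty hw.continuousOn
  have hmin : ∀ g, w g₀ ≤ w g := fun g => hg₀ (Set.mem_univ g)
  have hint : Integrable w (haarProbability G) :=
    Literature.Probability.LatticeModels.integrable_of_continuous_compactSpace _ hw
  have h1 : ∫ _g, w g₀ ∂(haarProbability G) ≤ ∫ g, w g ∂(haarProbability G) :=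
    integral_mono (integrable_const _) hint hmin
  have h2 : ∫ _g, w g₀ ∂(haarProbability G) = w g₀ := by simp
  linarith [hw0 g₀]

/-! ## §2 The heat-bath conditioners: normalised, local, squeezed -/

omit [NeZero L] [TopologicalSpace G] [IsTopologicalGroup G] [CompactSpace G] [SecondCountableTopology G]
  [MeasurableSpace G] [BorelSpace G] in
/-- The top link determines the plaquette: the fibre of `p ↦ (p + e₁, 0)` over the top link of a block
plaquette `p` is `{p}`. [ours] -/
theorem filter_topLink_eq_singleton (B : Finset (Site 2 L)) {p : Site 2 L} (hp : p ∈ B) :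
    B.filter (fun p' : Site 2 L => ((Site.shift p' 1, (0 : Fin 2)) : Edge 2 L) = (p.shift 1, 0)) = {p} := by
  ext p'
  simp only [mem_filter, mem_singleton]
  constructor
  · rintro ⟨-, h⟩
    have h1 : p'.shift 1 = p.shift 1 := congrArg Prod.fst h
    simpa [Site.shift] using h1
  · rintro rfl; exact ⟨hp, rfl⟩

omit [NeZero L] [TopologicalSpace G] [IsTopologicalGroup G] [CompactSpace G] [SecondCountableTopology G]
  [MeasurableSpace G] [BorelSpace G] in
/-- A link that tops no block plaquette has an empty fibre. [ours] -/
theorem filter_topLink_eq_empty (B : Finset (Site 2 L)) {b : Edge 2 L}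
    (hb : ∀ p ∈ B, ((p.shift 1, (0 : Fin 2)) : Edge 2 L) ≠ b) :
    B.filter (fun p' : Site 2 L => ((Site.shift p' 1, (0 : Fin 2)) : Edge 2 L) = b) = ∅ := by
  ext p'
  simp only [mem_filter, notMem_empty, iff_false, not_and]
  exact fun hp' h => hb p' hp' h

omit [SecondCountableTopology G] in
/-- **Every conditioner is normalised in its own link**: `∫ q_b(U[b ↦ v]) dHaar(v) = 1` for every link `b`
(`∫ w ≠ 0`, `L ≥ 2`).  For a top link the holonomy is `a·v⁻¹·a'` and Haar measure is inversion and
translation invariant; for any other link `q_b ≡ 1`. [ours] -/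
theorem heatBath_integral_update_eq_one (hL : 2 ≤ L) {w : G → ℝ}
    (hc : ∫ g, w g ∂(haarProbability G) ≠ 0) (B : Finset (Site 2 L)) (b : Edge 2 L) (U : GaugeConfig 2 L G) :
    ∫ v, ∏ p ∈ B.filter (fun p' : Site 2 L => ((Site.shift p' 1, (0 : Fin 2)) : Edge 2 L) = b),
        w (plaquetteHolonomy (update U b v) p 0 1) / (∫ g, w g ∂(haarProbability G)) ∂(haarProbability G) = 1 := by
  by_cases hb : ∃ p ∈ B, ((p.shift 1, (0 : Fin 2)) : Edge 2 L) = b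
  · obtain ⟨p, hp, hpb⟩ := hb
    subst hpb
    rw [filter_topLink_eq_singleton B hp]
    simp only [prod_singleton]
    have h01 : (0 : Fin 2) ≠ 1 := by decide
    simp only [plaquetteHolonomy_update_third hL U p h01]
    rw [integral_div]
    have hinv : ∫ v, w (U (p, 0) * U (p.shift 0, 1) * v⁻¹ * (U (p, 1))⁻¹) ∂(haarProbability G) =
        ∫ v, w v ∂(haarProbability G) := by
      have h2 : ∫ v, w (U (p, 0) * U (p.shift 0, 1) * v⁻¹ * (U (p, 1))⁻¹) ∂(haarProbability G) =
          ∫ v, w (U (p, 0) * U (p.shift 0, 1) * v * (U (p, 1))⁻¹) ∂(haarProbability G) :=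
        integral_inv_eq_self (fun g : G => w (U (p, 0) * U (p.shift 0, 1) * g * (U (p, 1))⁻¹))
          (haarProbability G)
      have h3 : ∫ v, w (U (p, 0) * U (p.shift 0, 1) * v * (U (p, 1))⁻¹) ∂(haarProbability G) =
          ∫ v, w (v * (U (p, 1))⁻¹) ∂(haarProbability G) :=
        integral_mul_left_eq_self (fun g' : G => w (g' * (U (p, 1))⁻¹)) (U (p, 0) * U (p.shift 0, 1))
      rw [h2, h3]
      exact integral_mul_right_eq_self (μ := haarProbability G) w _
    rw [hinv]
    exact div_self hc
  · push Not at hb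
    rw [filter_topLink_eq_empty B hb]
    simp

omit [NeZero L] [TopologicalSpace G] [IsTopologicalGroup G] [CompactSpace G] [SecondCountableTopology G]
  [MeasurableSpace G] [BorelSpace G] in
/-- **Locality**: `q_b` ignores the update of any link `e` that is not a link of a block plaquette topped by
`b`. [ours] -/
theorem heatBath_update_of_forall_ne {w : G → ℝ} (c : ℝ) (B : Finset (Site 2 L)) (b e : Edge 2 L)
    (he : ∀ p ∈ B, ((p.shift 1, (0 : Fin 2)) : Edge 2 L) = b →
      ((p, 0) : Edge 2 L) ≠ e ∧ ((p.shift 0, 1) : Edge 2 L) ≠ e ∧ ((p.shift 1, 0) : Edge 2 L) ≠ e ∧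
        ((p, 1) : Edge 2 L) ≠ e)
    (U : GaugeConfig 2 L G) (v : G) :
    ∏ p ∈ B.filter (fun p' : Site 2 L => ((Site.shift p' 1, (0 : Fin 2)) : Edge 2 L) = b),
        w (plaquetteHolonomy (update U e v) p 0 1) / c =
      ∏ p ∈ B.filter (fun p' : Site 2 L => ((Site.shift p' 1, (0 : Fin 2)) : Edge 2 L) = b),
        w (plaquetteHolonomy U p 0 1) / c := by
  refine prod_congr rfl fun p hp => ?_
  rw [mem_filter] at hp
  obtain ⟨h1, h2, h3, h4⟩ := he p hp.1 hp.2
  rw [plaquetteHolonomy_update_of_ne_links v h1 h2 h3 h4]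

omit [NeZero L] [TopologicalSpace G] [IsTopologicalGroup G] [CompactSpace G] [SecondCountableTopology G]
  [MeasurableSpace G] [BorelSpace G] in
/-- **Squeezing**: with `0 < m_w ≤ w ≤ M_w` and `c = ∫ w > 0`, every `q_b(U)` lies in
`[min 1 (m_w/c), max 1 (M_w/c)]` (the fibre over `b` is empty or a singleton). [ours] -/
theorem heatBath_squeezed {w : G → ℝ} {mw Mw : ℝ} (hmw : ∀ g, mw ≤ w g) (hMw : ∀ g, w g ≤ Mw)
    {c : ℝ} (hc : 0 < c) (B : Finset (Site 2 L)) (b : Edge 2 L) (U : GaugeConfig 2 L G) :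
    min 1 (mw / c) ≤ ∏ p ∈ B.filter (fun p' : Site 2 L => ((Site.shift p' 1, (0 : Fin 2)) : Edge 2 L) = b),
        w (plaquetteHolonomy U p 0 1) / c ∧
      ∏ p ∈ B.filter (fun p' : Site 2 L => ((Site.shift p' 1, (0 : Fin 2)) : Edge 2 L) = b),
        w (plaquetteHolonomy U p 0 1) / c ≤ max 1 (Mw / c) := by
  by_cases hb : ∃ p ∈ B, ((p.shift 1, (0 : Fin 2)) : Edge 2 L) = b
  · obtain ⟨p, hp, hpb⟩ := hb
    subst hpb
    rw [filter_topLink_eq_singleton B hp, prod_singleton]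
    exact ⟨(min_le_right _ _).trans (div_le_div_of_nonneg_right (hmw _) hc.le),
      (div_le_div_of_nonneg_right (hMw _) hc.le).trans (le_max_right _ _)⟩
  · push Not at hb
    rw [filter_topLink_eq_empty B hb, prod_empty]
    exact ⟨min_le_left _ _, le_max_left _ _⟩

/-! ## §3 Exactness -/

omit [TopologicalSpace G] [IsTopologicalGroup G] [CompactSpace G] [SecondCountableTopology G]
  [MeasurableSpace G] [BorelSpace G] in
/-- **`∏_b q_b(U) = F(U)/c^{R·T₀}`** — the product of all conditioners is the block weight over the power of
the one-plaquette integral (fibrewise product over the top-link map; the block has `R·T₀` sites by `Scoring/SU2TorusRectangleSites.card_rectSites`). [ours] -/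
theorem prod_heatBath_eq {w : G → ℝ} (c : ℝ) (i j : ZMod L) {R T₀ : ℕ} (hR : R ≤ L) (hT₀ : T₀ ≤ L)
    (U : GaugeConfig 2 L G) :
    ∏ b : Edge 2 L, ∏ p ∈ ((range R ×ˢ range T₀).image
        (fun q : ℕ × ℕ => (![i + q.1, j + q.2] : Site 2 L))).filter
          (fun p' : Site 2 L => ((Site.shift p' 1, (0 : Fin 2)) : Edge 2 L) = b), w (plaquetteHolonomy U p 0 1) / c =
      (∏ p ∈ (range R ×ˢ range T₀).image (fun q : ℕ × ℕ => (![i + q.1, j + q.2] : Site 2 L)),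
        w (plaquetteHolonomy U p 0 1)) / c ^ (R * T₀) := by
  rw [prod_fiberwise_of_maps_to (g := fun p' : Site 2 L => ((Site.shift p' 1, (0 : Fin 2)) : Edge 2 L))
    (fun _ _ => mem_univ _), prod_div_distrib, prod_const, card_rectSites i j hR hT₀]

/-- **EXACTNESS: the heat-bath autoregressive hybrid IS the target.**  `w` continuous and positive, `0 < R`,
`R + 1 ≤ L`, `T₀ + 1 ≤ L`; for every duplicate-free list `l` of ALL links:
`(∏_{b∈l} q_b(U)) · A_{l}F(U)/Z = F(U)/Z` for every `U`, where `A_l F = ∫F = Z`. [ours] -/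
theorem freeBlock_arHybrid_eq_target {w : G → ℝ} (hw : Continuous w) (hw0 : ∀ g, 0 < w g) (i j : ZMod L)
    {R T₀ : ℕ} (hR0 : 0 < R) (hR : R + 1 ≤ L) (hT₀ : T₀ + 1 ≤ L)
    (l : List (Edge 2 L)) (hl : l.Nodup) (hall : ∀ e : Edge 2 L, e ∈ l) (U : GaugeConfig 2 L G) :
    (l.map fun b => ∏ p ∈ ((range R ×ˢ range T₀).image
        (fun q : ℕ × ℕ => (![i + q.1, j + q.2] : Site 2 L))).filter
          (fun p' : Site 2 L => ((Site.shift p' 1, (0 : Fin 2)) : Edge 2 L) = b),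
        w (plaquetteHolonomy U p 0 1) / (∫ g, w g ∂(haarProbability G))).prod *
        coordAvg (haarProbability G) l.toFinset
          (fun V : GaugeConfig 2 L G => ∏ p ∈ (range R ×ˢ range T₀).image
            (fun q : ℕ × ℕ => (![i + q.1, j + q.2] : Site 2 L)), w (plaquetteHolonomy V p 0 1)) U /
        (∫ V, ∏ p ∈ (range R ×ˢ range T₀).image (fun q : ℕ × ℕ => (![i + q.1, j + q.2] : Site 2 L)),
          w (plaquetteHolonomy V p 0 1) ∂(Measure.pi fun _ : Edge 2 L => haarProbability G)) =
      (∏ p ∈ (range R ×ˢ range T₀).image (fun q : ℕ × ℕ => (![i + q.1, j + q.2] : Site 2 L)),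
          w (plaquetteHolonomy U p 0 1)) /
        (∫ V, ∏ p ∈ (range R ×ˢ range T₀).image (fun q : ℕ × ℕ => (![i + q.1, j + q.2] : Site 2 L)),
          w (plaquetteHolonomy V p 0 1) ∂(Measure.pi fun _ : Edge 2 L => haarProbability G)) := by
  have hc : 0 < ∫ g, w g ∂(haarProbability G) :=
    haarProbability_integral_pos_of_continuous_pos hw hw0
  have hZ := freeBlock_integral_prod_eq_pow (G := G) hw i j hR0 hR hT₀
  have hZpos : 0 < ∫ V, ∏ p ∈ (range R ×ˢ range T₀).image (fun q : ℕ × ℕ => (![i + q.1, j + q.2] : Site 2 L)),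
      w (plaquetteHolonomy V p 0 1) ∂(Measure.pi fun _ : Edge 2 L => haarProbability G) := by
    rw [hZ]; exact pow_pos hc _
  have hto : l.toFinset = Finset.univ := eq_univ_iff_forall.mpr fun e => List.mem_toFinset.mpr (hall e)
  rw [← List.prod_toFinset _ hl, hto, prod_heatBath_eq _ i j (by omega) (by omega), coordAvg_univ, hZ]
  field_simp

/-- **`KL(F/Z ‖ H_l) = 0`**: `∫ (F/Z)·log((F/Z)/H_l) dHaar^{⊗E} = 0` under the hypotheses of
`freeBlock_arHybrid_eq_target`. [ours] -/
theorem freeBlock_kl_arHybrid_eq_zero {w : G → ℝ} (hw : Continuous w) (hw0 : ∀ g, 0 < w g) (i j : ZMod L)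
    {R T₀ : ℕ} (hR0 : 0 < R) (hR : R + 1 ≤ L) (hT₀ : T₀ + 1 ≤ L)
    (l : List (Edge 2 L)) (hl : l.Nodup) (hall : ∀ e : Edge 2 L, e ∈ l) :
    ∫ U, (∏ p ∈ (range R ×ˢ range T₀).image (fun q : ℕ × ℕ => (![i + q.1, j + q.2] : Site 2 L)),
          w (plaquetteHolonomy U p 0 1)) /
        (∫ V, ∏ p ∈ (range R ×ˢ range T₀).image (fun q : ℕ × ℕ => (![i + q.1, j + q.2] : Site 2 L)),
          w (plaquetteHolonomy V p 0 1) ∂(Measure.pi fun _ : Edge 2 L => haarProbability G)) *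
      Real.log (((∏ p ∈ (range R ×ˢ range T₀).image (fun q : ℕ × ℕ => (![i + q.1, j + q.2] : Site 2 L)),
          w (plaquetteHolonomy U p 0 1)) /
        (∫ V, ∏ p ∈ (range R ×ˢ range T₀).image (fun q : ℕ × ℕ => (![i + q.1, j + q.2] : Site 2 L)),
          w (plaquetteHolonomy V p 0 1) ∂(Measure.pi fun _ : Edge 2 L => haarProbability G))) /
        ((l.map fun b => ∏ p ∈ ((range R ×ˢ range T₀).image
          (fun q : ℕ × ℕ => (![i + q.1, j + q.2] : Site 2 L))).filter
            (fun p' : Site 2 L => ((Site.shift p' 1, (0 : Fin 2)) : Edge 2 L) = b),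
          w (plaquetteHolonomy U p 0 1) / (∫ g, w g ∂(haarProbability G))).prod *
        coordAvg (haarProbability G) l.toFinset
          (fun V : GaugeConfig 2 L G => ∏ p ∈ (range R ×ˢ range T₀).image
            (fun q : ℕ × ℕ => (![i + q.1, j + q.2] : Site 2 L)), w (plaquetteHolonomy V p 0 1)) U /
        (∫ V, ∏ p ∈ (range R ×ˢ range T₀).image (fun q : ℕ × ℕ => (![i + q.1, j + q.2] : Site 2 L)),
          w (plaquetteHolonomy V p 0 1) ∂(Measure.pi fun _ : Edge 2 L => haarProbability G))))
      ∂(Measure.pi fun _ : Edge 2 L => haarProbability G) = 0 := by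
  refine integral_eq_zero_of_ae (ae_of_all _ fun U => ?_)
  have h := freeBlock_arHybrid_eq_target (G := G) hw hw0 i j hR0 hR hT₀ l hl hall U
  rw [Pi.zero_apply]
  beta_reduce
  rw [h]
  have hc : 0 < ∫ g, w g ∂(haarProbability G) := haarProbability_integral_pos_of_continuous_pos hw hw0
  have hZ := freeBlock_integral_prod_eq_pow (G := G) hw i j hR0 hR hT₀
  have hF : 0 < (∏ p ∈ (range R ×ˢ range T₀).image (fun q : ℕ × ℕ => (![i + q.1, j + q.2] : Site 2 L)),
      w (plaquetteHolonomy U p 0 1)) := prod_pos fun p _ => hw0 _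
  have hZpos : 0 < ∫ V, ∏ p ∈ (range R ×ˢ range T₀).image (fun q : ℕ × ℕ => (![i + q.1, j + q.2] : Site 2 L)),
      w (plaquetteHolonomy V p 0 1) ∂(Measure.pi fun _ : Edge 2 L => haarProbability G) := by
    rw [hZ]; exact pow_pos hc _
  rw [div_self (div_pos hF hZpos).ne', Real.log_one, mul_zero]

end Summit.Ventures.LatticeQCDFlow.Theory2.Autoregressive

end
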